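import Summits.BirchSwinnertonDyer.BirchSwinnertonDyer.Theses.GenusKolyvaginAtTwo
import Summits.BirchSwinnertonDyer.BirchSwinnertonDyer.Theses.ByReductionTypeAtTwo
import Literature.NumberTheory.EllipticCurves.SelmerTrivialCorankProofs
import Literature.NumberTheory.EllipticCurves.BSDRootNumberSmallConductorProofs
import Literature.NumberTheory.EllipticCurves.KrizLi2019.AssumptionStarTwoPrimitiveProofs
import HarnessLib

/-!
# LINE 31 «su_halves⁺» — the Δ > 0 MIRROR of LINE 30 «su_halves», on crux K₁⁺ `K1Pos` (stmt-BirchSwinnertonDyer-31468), route `GenusKolyvaginAtTwo`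

MIRROR NOTICE: mechanism, stubs and compositions are those of LINE 30 (`Cruxes/K1Neg/Lines/su_halves.lean`, K₁⁻) with the two
sign-specific clauses of the kernel item swapped (`0 < W.Δ` for `W.Δ < 0`; twin budget `ord₂ C(Wd) = 0` for `≤ 1` — the K₁⁺ cell of
`closes`, where `c_∞(E) = 2` replaces the one allowed even Tamagawa factor of the twin).  Filed so that the K₁⁺ kernel has a line of its own;
not a new mechanism.

Ideator seat `bsd-idea-1` (D-0145), generation 26; technique card «compactness–contradiction / rigidity».  A LINES workfile: the
`theorem stub_* … := by sorry` are the REGISTERED STUBS; `K1Pos_of` is the kernel-checked composition concluding the crux BY NAME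
(`Summit.BirchSwinnertonDyer.BirchSwinnertonDyer.Theses.GenusKolyvaginAtTwo.K1Pos`) modulo the route's four PRINT items
`GrossZagierAllLevels` (24148), `MultPublishedInputsAtTwo` (19921), `EntireLFunctionRat` (19273), `MilneAnyModel` (24149) — exactly the
print binders of the LEAD's losslessness certificate `GenusSupplyNarrow.Lossless.K1_of_nonCMAtTwo`.  **No summit is proved by a line; BSD is not
proved here; K1Pos is NOT proved here (five `sorry`s = five stubs A, B1′, B2′, B3, G′; v1.3 = critic #503 P1 fix: B1′/B2′/B′ carry ONLY the twin `Wd` + its provenance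
`(W, K, hWd)` (no Heegner datum, no `M₀`), G′ is the ledger for EVERY depth `M₀ ≥ 0` (no `hM₀ : 1 ≤ M₀`) — so `K1Pos` (whose frame is contradictory) no longer implies
any stub ex falso; A and B3 were frame-free already).**

## The lever (new on this crux): DECOUPLE THE PAIR INTO ITS TWO ONE-SIDED («Skinner–Urban direction») HALVES

K₁ says: on the depth-zero cell (`E = W` non-CM of analytic rank `0`, `ρ̄_(E,2^∞)` onto, `C(E)` odd, `Δ < 0`, `#Sel₂(E) = 1`; `K` an (H2)-field;
odd-Manin `Dt`; the `Sel₂`-minimal rank-one twin `Wd ≅ E^(d_K)` with `ord₂ C(Wd) ≤ 1`) the Heegner point is `2`-PRIMITIVE: `2^(M₀) ∣ y_K` with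
`M₀ ≥ 1` is absurd.  Valuation ledger (Gross–Zagier V (2.2) at `c` odd, `u_K = 1`: `ord₂ Ш_an(E/K) = 2·M₀`; Milne 1972: the BSD DEFECT is additive
over `K/ℚ`, `δ(E/K) = δ(E) + δ(E^(d_K))`, `δ := ord₂ Ш_an − ord₂ #Ш[2^∞]`; and on this cell ALL THREE algebraic `Ш[2^∞]` VANISH unconditionally —
`Ш(E/K)[2^∞] = 0` is the LEAD's `Lossless.natCard_primaryComponent_sha_baseChange_two_eq_one_of_natCard_selmerGroup_eq_one`, `Ш(E)[2] = 0` from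
`#Sel₂(E) = 1`, `Ш(Wd)[2] = 0` from `#Sel₂(Wd) = 2 = 2^(rank)`):

  **`2·M₀ = ord₂ Ш_an(E) + ord₂ Ш_an(E^(d_K))`**  (mod PRINT)  — stub G `stub_valuationLedger` (inequality form `≤`, all the composition uses).

So K₁ ⟺ `ord₂ Ш_an(E) + ord₂ Ш_an(Wd) ≤ 0`, and it SUFFICES to prove the two ONE-SIDED, SINGLE-CURVE, RANK-PURE halves
* A `stub_rankZeroHalf`: a rank-`0` curve of the cell has `ord₂ Ш_an(E) ≤ 0` — «trivial `2`-Selmer ⟹ `2`-adic unit `L(E,1)/Ω`», the RANK-ZERO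
  `2`-CONVERSE in the L-value direction (Skinner–Urban's direction; at `p = 2` beyond print).  On `Δ < 0` the `2`-division field is a COMPLEX
  cubic field `L` and `ρ̄_(E,2) : G_ℚ → GL₂(𝔽₂) = S₃` is an odd DIHEDRAL Artin representation `σ = Ind_(ℚ(√Δ))(χ₃)` with weight-ONE theta series
  `h`, `f_E ≡ h (mod 2)` (Li 2019 §5.1); `#Sel₂(E) = 1` ⟹ `Cl(L)[2] = 0` (Li 2019 Thm. 1.4 / Brumer–Kramer), and `L(h,1) = (ζ_L/ζ)(1)` carries
  `h(L)` by the class number formula: A is EXACTLY the rank-`0` case of the mod-`2` congruence of algebraic parts `L(f,1) «≡» L(h,1)` that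
  Li 2019 §5.4 asks to formulate and prove («We hope to formulate this type of mod 2 congruence between L-values more precisely in the future»).
* B (v1.1: PROVED as `rankOneHalf_of_swap` from B1–B3 + a tree theorem): the rank-`1` twin has `ord₂ Ш_an(Wd) ≤ 0`.  FRAME SWAP — B1
  `stub_starFrameSupply` (∃ an auxiliary Heegner frame `K'` of `Wd` with `2` split where Kriz–Li's Assumption (★) holds for the Heegner point
  `P' ∈ Wd(K')`, odd `c(Dt')`, odd `c₂(Wd)`, rank-`0` partner `W' ≅ Wd^(d_(K'))` without rational `2`-torsion), the TREE THEOREM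
  `KrizLi2019.not_exists_two_zsmul_eq_of_assumptionStar` ((★) ⟹ `P' ∉ 2·Wd(K')`: depth ZERO at the swapped frame), B2 `stub_swappedLedger`
  (Gross–Zagier + Milne at `(Wd, K')`: `ord₂ Ш_an(Wd) + ord₂ Ш_an(W') + ord₂ C(W') ≤ 0`, print-shaped) and B3 `stub_rankZeroIntegrality`
  (`ord₂ (Ш_an(W')·C(W')) ≥ 0`: modular-symbol INTEGRALITY for a rank-`0` curve without `2`-torsion — integrality, not a unit statement).
  So the rank-one half needs NO `2`-converse: only ONE (★)-frame.
Neither half is needed in the Kato/integrality direction: K₁ consumes only the two SU-direction inequalities.  A ∧ B is stronger than K₁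
(K₁ is their SUM); each of A, B is a consequence of `BSD₂` of ONE curve and implies nothing about the other.

CHEAPEST FALSIFIER: a rank-`0` curve with `#Sel₂ = 1`, `Δ < 0`, odd `C`, surjective `ρ̄_(2^∞)` and EVEN numerator of `L(E,1)·#tors²/(Ω·C)` kills A
(and BSD); Cremona/LMFDB `sha_an` columns over `N < 500000` are the instrument (analytic `Ш` is listed as an exact rational in rank `0, 1`).

References: [GrossZagier1986] V §2 (2.2) · [GrossLMS1991] §2 (2.2) · [Milne1972ArithmeticAV] §1 Thm. 1 · [Miller2011LMS] Def. 1.1 ·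
[KrizLi2019] Thm. 1.16, Thm. 5.1, Cor. 5.5 · Li, *2-Selmer groups, 2-class groups and rational points on elliptic curves*, TAMS 371 (2019)
Thm. 1.4, §5.1, §5.4 (doi:10.1090/tran/7373) · [BrumerKramer1977] · [SkinnerUrban2014] (p odd; the direction of A).
-/

set_option autoImplicit false
set_option linter.dupNamespace false
set_option linter.unusedVariables false

noncomputable section

open scoped Classical

namespace Summit.BirchSwinnertonDyer.BirchSwinnertonDyer.Cruxes.K1Pos.SuHalves

open WeierstrassCurve NumberField IsDedekindDomain Field Literature.NumberTheory.EllipticCurves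
  Literature.NumberTheory.GaloisRepresentations Literature.NumberTheory.EllipticCurves.ModularForms
open Summit.BirchSwinnertonDyer.BirchSwinnertonDyer.Theses.GenusKolyvaginAtTwo
open Literature.NumberTheory.EllipticCurves.KrizLi2019

/-- **A⁺ (Δ > 0 mirror; further from print than A: the cubic `2`-division field is TOTALLY REAL, `ρ̄` is EVEN, no weight-one avatar — the relative engine is Zhai 2016, arXiv:1409.0231 Thm 1.1) — THE RANK-ZERO HALF (stub, rank 1 of the line = its bet).**  A globally minimal non-CM `E = W/ℚ` of analytic rank `0` with
`ρ̄_(E,2^n)` onto for all `n`, odd Tamagawa product, `Δ < 0` and TRIVIAL `2`-Selmer group has `2`-integral-free analytic `Ш`: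
`#Ш_an(E) = L(E,1)·#E(ℚ)_tors²/(Ω·C) ∈ ℚ` with `ord₂ ≤ 0` (BSD₂ predicts `= ord₂ #Ш(E)[2^∞] = 0`).  The rank-`0` `2`-converse in the
L-value direction; on `Δ < 0` it is the rank-`0` case of Li's conjectural mod-`2` congruence `L(f_E,1) «≡» L(h,1) = (ζ_L/ζ)(1)` with the
weight-one dihedral form `h ≡ f_E (mod 2)` of the complex cubic `2`-division field `L`, `Cl(L)[2] = 0` being forced by `#Sel₂(E) = 1`.
Why it might fail: only with BSD₂(E).  [cite: Miller2011LMS, Def. 1.1] [cite: KrizLi2019, Cor. 5.5] Li 2019 (doi:10.1090/tran/7373) Thm. 1.4, §5.4. -/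
theorem stub_rankZeroHalf
    (W : WeierstrassCurve ℚ) [W.IsElliptic] [W.IsGloballyMinimal] [NeZero (W.conductorNorm ℤ)]
    (hcm : ¬ W.HasCM) (hr0 : W.analyticRank = 0) (hρ : ∀ n : ℕ, 0 < n → W.HasSurjectiveModNGaloisRep ((2 : ℤ) ^ n))
    (hT : Odd W.tamagawaProduct) (hpos : 0 < W.Δ) (hSel1 : Nat.card (W.selmerGroup 2) = 1) :
    ∃ q : ℚ, shaAn W = (q : ℂ) ∧ padicValRat 2 q ≤ 0 := by
  sorry

/-! ## B — THE RANK-ONE HALF, v1.1: FRAME SWAP onto a Kriz–Li (★)-frame of the twin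

`ord₂ Ш_an(Wd) ≤ 0` is a statement about the rank-one curve `Wd` ALONE; its provenance frame `(E, K)` is the worst place to prove it
(`2 ∤ d_K` is inert-or-ramified bookkeeping and the depth there is `M₀ ≥ 1`).  Swap to an AUXILIARY frame of `Wd`: an imaginary quadratic
`K'` with `2` SPLIT, Heegner for `N(Wd)`, whose Heegner point `P' = y_(K') ∈ Wd(K')` satisfies Kriz–Li's Assumption (★) — then
`P' ∉ 2·Wd(K')` is the TREE THEOREM `KrizLi2019.not_exists_two_zsmul_eq_of_assumptionStar` (depth ZERO at the swapped frame), the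
Gross–Zagier ledger at `(Wd, K')` bounds `ord₂ Ш_an(Wd) + ord₂ L_alg(W')` by `0` (B2, print-shaped), and the RANK-ZERO partner
`W' ≅ Wd^(d_(K')) = E^(d_K·d_(K'))` contributes `ord₂ L_alg(W') ≥ 0` by modular-symbol INTEGRALITY (B3) — integrality, not a unit
statement: the rank-one half needs NO `2`-converse at all, only the supply of ONE (★)-frame (B1). -/

/-- **B1 — (★)-FRAME SUPPLY FOR THE TWIN (stub, rank 2; the rank-one half's real content).**  On a K₁ frame, the twin `Wd` (analytic rank `1`,
`#Sel₂(Wd) = 2`, `ρ̄_(Wd,2) = ρ̄_(E,2) ⊗ χ` onto) admits an auxiliary Heegner frame `K'` (imaginary quadratic, Heegner for `N(Wd)`, `2` split —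
part of (★)) with an odd-Manin parametrisation `Dt'`, level-one Kolyvagin data `d₁'` whose basic Heegner point descends to `P' ∈ Wd(K')`,
a prime `j : K' → ℚ₂` at which (★) holds, odd `c₂(Wd)`, and a globally minimal rank-zero partner `W' ≅ Wd^(d_(K'))` without rational `2`-torsion.
Why plausible: Kriz–Li, Thm. 1.5/1.12 + §5 produce (★)-frames for every curve in their Table 1 families and (★) propagates along the whole twist
class `𝒩` (Thm. 3.3); (★) forces `Ш(Wd)[2] = 0`-type conclusions, consistent with `#Sel₂(Wd) = 2 = 2^rank`.  Why it might fail: a twin `Wd` for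
which `|Ẽ^ns(𝔽₂)|·log_ω(P')/2` is EVEN at every split `K'` (no (★)-frame at all) — instrument: Kriz–Li's Table 1 recipe on the K₁ frames of
kit `j339298` (curves 11a-type excluded by `ρ̄₂` onto).  [cite: KrizLi2019, Assumption (★), Thm. 1.12, Thm. 3.3 (arXiv:1606.03172)] -/
theorem stub_starFrameSupply
    (W : WeierstrassCurve ℚ) [W.IsElliptic] [W.IsGloballyMinimal] [NeZero (W.conductorNorm ℤ)]
    (hcm : ¬ W.HasCM) (hr0 : W.analyticRank = 0) (hρ : ∀ n : ℕ, 0 < n → W.HasSurjectiveModNGaloisRep ((2 : ℤ) ^ n))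
    (hT : Odd W.tamagawaProduct) (hpos : 0 < W.Δ) (hSel1 : Nat.card (W.selmerGroup 2) = 1)
    (K : Type) [Field K] [NumberField K] (hIQ : IsImaginaryQuadratic K) (hodd : Odd (NumberField.discr K))
    (h3 : NumberField.discr K ≠ -3) (hHe : SatisfiesHeegnerHypothesis (W.conductorNorm ℤ) K)
    (hsq1 : ¬ IsSquare ((NumberField.discr K : ℚ) * -|W.Δ|)) (hsq2 : ¬ IsSquare ((NumberField.discr K : ℚ) * (-(2 * |W.Δ|))))
    (Wd : WeierstrassCurve ℚ) [Wd.IsElliptic] [Wd.IsGloballyMinimal]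
    (hWd : ∃ C : VariableChange ℚ, C • W.quadraticTwist (NumberField.discr K : ℚ) = Wd)
    (hrd : Wd.analyticRank = 1) (hSel : Nat.card (Wd.selmerGroup 2) = 2) (hDEF : padicValNat 2 Wd.tamagawaProduct = 0) [NeZero (Wd.conductorNorm ℤ)] :
    ∃ (K' : Type) (_ : Field K') (_ : NumberField K'), IsImaginaryQuadratic K' ∧
      SatisfiesHeegnerHypothesis (Wd.conductorNorm ℤ) K' ∧
      ∃ (Dt' : ModularParametrizationData Wd (Wd.conductorNorm ℤ)), Odd Dt'.c ∧
      ∃ (β' : ℤ) (ι' : K' →+* ℂ) (d₁' : KolyvaginHeegnerData Dt' β' ι' 1) (P' : (Wd.baseChange K').toAffine.Point)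
        (j : K' →ₐ[ℚ] ℚ_[2]),
        WeierstrassCurve.Affine.Point.map (algebraMap K' (ringClassField K' ι' 1)).toRatAlgHom P' = d₁'.derivedPoint ∧
        AssumptionStar Wd Dt' K' P' j ∧
        (haveI : Fact (Nat.Prime 2) := ⟨Nat.prime_two⟩; Odd ((Wd.baseChange ℚ_[2]).localTamagawaNumber ℤ_[2])) ∧
      ∃ (W' : WeierstrassCurve ℚ) (_ : W'.IsElliptic) (_ : W'.IsGloballyMinimal),
        (∃ C : VariableChange ℚ, C • Wd.quadraticTwist (NumberField.discr K' : ℚ) = W') ∧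
        W'.analyticRank = 0 ∧ (∀ Q : W'.toAffine.Point, 2 • Q = 0 → Q = 0) := by
  sorry

/-- **B2 — THE SWAPPED GROSS–ZAGIER LEDGER (stub, rank 4; PRINT-shaped bookkeeping).**  At the swapped frame `(Wd, K')` (rank `1 + 0` over `K'`,
no `2`-torsion, `P' = y_(K')` `2`-indivisible in `Wd(K')`, `c(Dt')` odd, `u_(K') = 1`): Gross–Zagier V (2.2) + Kolyvagin give
`[Wd(K') : ℤ P']² ≐ #Ш_an(Wd/K') · ∏_v c_v(Wd/K')` with ODD index, and Milne's quotient identity splits `Ш_an(Wd/K') ≐ Ш_an(Wd)·Ш_an(W')`;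
in valuations: **`ord₂ #Ш_an(Wd) + ord₂ #Ш_an(W') + ord₂ C(W') ≤ 0`** (the form the composition uses; `#Ш_an(Wd) ∈ ℚ` included).
Why it might fail: it is print-level, but the `2`-power bookkeeping of the period ratio `Ω(Wd/K') / (Ω(Wd)·Ω(W'))`, of `c_v(Wd/K')` against
`C(Wd)·C(W')` (here `ord₂ C(Wd) ≤ 1`) and of the Manin constants must close EXACTLY — the LEAD's currency theorems
(`padicValRat_shaAnOverC_heegnerC`, `shaExactC_of_bsdp_at`) are the template; a constant offset would have to be moved into B3.
[cite: GrossZagier1986, V §2 (2.2)] [cite: GrossLMS1991, §2 (2.4)] [cite: Milne1972ArithmeticAV, §1 Thm. 1] [cite: KrizLi2019, Thm. 5.1, Cor. 5.5] -/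
theorem stub_swappedLedger (hGZ : GrossZagierAllLevels) (hGZK : MultPublishedInputsAtTwo) (hL : EntireLFunctionRat)
    (hMi : MilneAnyModel)
    (W : WeierstrassCurve ℚ) [W.IsElliptic] [W.IsGloballyMinimal] [NeZero (W.conductorNorm ℤ)]
    (hcm : ¬ W.HasCM) (hr0 : W.analyticRank = 0) (hρ : ∀ n : ℕ, 0 < n → W.HasSurjectiveModNGaloisRep ((2 : ℤ) ^ n))
    (hT : Odd W.tamagawaProduct) (hpos : 0 < W.Δ) (hSel1 : Nat.card (W.selmerGroup 2) = 1)
    (K : Type) [Field K] [NumberField K] (hIQ : IsImaginaryQuadratic K) (hodd : Odd (NumberField.discr K))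
    (h3 : NumberField.discr K ≠ -3) (hHe : SatisfiesHeegnerHypothesis (W.conductorNorm ℤ) K)
    (hsq1 : ¬ IsSquare ((NumberField.discr K : ℚ) * -|W.Δ|)) (hsq2 : ¬ IsSquare ((NumberField.discr K : ℚ) * (-(2 * |W.Δ|))))
    (Wd : WeierstrassCurve ℚ) [Wd.IsElliptic] [Wd.IsGloballyMinimal]
    (hWd : ∃ C : VariableChange ℚ, C • W.quadraticTwist (NumberField.discr K : ℚ) = Wd)
    (hrd : Wd.analyticRank = 1) (hSel : Nat.card (Wd.selmerGroup 2) = 2) (hDEF : padicValNat 2 Wd.tamagawaProduct = 0) [NeZero (Wd.conductorNorm ℤ)]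
    (K' : Type) [Field K'] [NumberField K'] (hIQ' : IsImaginaryQuadratic K')
    (hHe' : SatisfiesHeegnerHypothesis (Wd.conductorNorm ℤ) K')
    (Dt' : ModularParametrizationData Wd (Wd.conductorNorm ℤ)) (hc' : Odd Dt'.c)
    (β' : ℤ) (ι' : K' →+* ℂ) (d₁' : KolyvaginHeegnerData Dt' β' ι' 1)
    (P' : (Wd.baseChange K').toAffine.Point)
    (hP' : WeierstrassCurve.Affine.Point.map (algebraMap K' (ringClassField K' ι' 1)).toRatAlgHom P' = d₁'.derivedPoint)
    (hnd : ¬ ∃ Q : (Wd.baseChange K').toAffine.Point, (2 : ℤ) • Q = P')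
    (W' : WeierstrassCurve ℚ) [W'.IsElliptic] [W'.IsGloballyMinimal]
    (hW' : ∃ C : VariableChange ℚ, C • Wd.quadraticTwist (NumberField.discr K' : ℚ) = W')
    (hr' : W'.analyticRank = 0) (ht' : ∀ Q : W'.toAffine.Point, 2 • Q = 0 → Q = 0)
    (q' : ℚ) (hq' : shaAn W' = (q' : ℂ)) :
    ∃ qd : ℚ, shaAn Wd = (qd : ℂ) ∧ padicValRat 2 qd + padicValRat 2 q' + (padicValNat 2 W'.tamagawaProduct : ℤ) ≤ 0 := by
  sorry

/-- **B3 — RANK-ZERO INTEGRALITY AT 2 (stub, rank 5; known-type).**  A globally minimal `W'/ℚ` of analytic rank `0` WITHOUT rational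
`2`-torsion has `2`-INTEGRAL algebraic L-value: `ord₂ (#Ш_an(W') · C(W')) = ord₂ (L(W',1)·#tors²/Ω) ≥ 0`.  Why plausible: modular symbols —
`L(W',1)/Ω⁺ ∈ (c_Manin · #W'(ℚ)_tors)⁻¹ · ℤ[½]`-type integrality with the `2` controlled when `W'(ℚ)[2] = 0` and the Manin constant is odd
(Abbes–Ullmo; Česnavičius 2018 for semistable; Edixhoven); the only `2`-adic subtlety is `Ω` versus `Ω⁺` on `Δ(W') > 0` (one factor `2`,
on the right side of the inequality).  Why it might fail: an even Manin constant or the `Ω/Ω⁺` factor landing on the wrong side for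
`Δ(W') > 0` — instrument: LMFDB `sha_an·tamagawa_product` over rank-0 curves with trivial 2-torsion (must be a 2-adic integer in every row).
[cite: Miller2011LMS, Def. 1.1] [cite: EdixhovenManin1991, §1] [cite: KrizLi2019, Cor. 5.5] -/
theorem stub_rankZeroIntegrality
    (W' : WeierstrassCurve ℚ) [W'.IsElliptic] [W'.IsGloballyMinimal]
    (hr' : W'.analyticRank = 0) (ht' : ∀ Q : W'.toAffine.Point, 2 • Q = 0 → Q = 0) :
    ∃ q' : ℚ, shaAn W' = (q' : ℂ) ∧ 0 ≤ padicValRat 2 q' + (padicValNat 2 W'.tamagawaProduct : ℤ) := by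
  sorry

/-- **B — THE RANK-ONE HALF, PROVED (v1.1) from B1 (supply) + Kriz–Li (tree theorem) + B2 (ledger) + B3 (integrality)**, modulo the four
print items.  Statement = v1.0's `stub_rankOneHalf` verbatim (plus the print binders).  No `sorry` of its own. -/
theorem rankOneHalf_of_swap (hGZ : GrossZagierAllLevels) (hGZK : MultPublishedInputsAtTwo) (hL : EntireLFunctionRat)
    (hMi : MilneAnyModel)
    (W : WeierstrassCurve ℚ) [W.IsElliptic] [W.IsGloballyMinimal] [NeZero (W.conductorNorm ℤ)]
    (hcm : ¬ W.HasCM) (hr0 : W.analyticRank = 0) (hρ : ∀ n : ℕ, 0 < n → W.HasSurjectiveModNGaloisRep ((2 : ℤ) ^ n))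
    (hT : Odd W.tamagawaProduct) (hpos : 0 < W.Δ) (hSel1 : Nat.card (W.selmerGroup 2) = 1)
    (K : Type) [Field K] [NumberField K] (hIQ : IsImaginaryQuadratic K) (hodd : Odd (NumberField.discr K))
    (h3 : NumberField.discr K ≠ -3) (hHe : SatisfiesHeegnerHypothesis (W.conductorNorm ℤ) K)
    (hsq1 : ¬ IsSquare ((NumberField.discr K : ℚ) * -|W.Δ|)) (hsq2 : ¬ IsSquare ((NumberField.discr K : ℚ) * (-(2 * |W.Δ|))))
    (Wd : WeierstrassCurve ℚ) [Wd.IsElliptic] [Wd.IsGloballyMinimal]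
    (hWd : ∃ C : VariableChange ℚ, C • W.quadraticTwist (NumberField.discr K : ℚ) = Wd)
    (hrd : Wd.analyticRank = 1) (hSel : Nat.card (Wd.selmerGroup 2) = 2) (hDEF : padicValNat 2 Wd.tamagawaProduct = 0) :
    ∃ q : ℚ, shaAn Wd = (q : ℂ) ∧ padicValRat 2 q ≤ 0 := by
  haveI : NeZero (Wd.conductorNorm ℤ) := ⟨(Wd.conductorNorm_pos_holds).ne'⟩
  obtain ⟨K', _, _, hIQ', hHe', Dt', hc', β', ι', d₁', P', j, hP', hstar, hc2, W', _, _, hW', hr', ht'⟩ :=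
    stub_starFrameSupply W hcm hr0 hρ hT hpos hSel1 K hIQ hodd h3 hHe hsq1 hsq2 Wd hWd hrd hSel hDEF
  -- Kriz–Li: (★) ⟹ the Heegner point is not `2`-divisible in `Wd(K')` (TREE THEOREM, arXiv:1606.03172 Lemma 4.1 / FMS Lemma 5.4)
  have hnd : ¬ ∃ Q : (Wd.baseChange K').toAffine.Point, (2 : ℤ) • Q = P' :=
    not_exists_two_zsmul_eq_of_assumptionStar Wd Dt' K' P' j hstar hc2 hc'
  obtain ⟨q', hq', hB3⟩ := stub_rankZeroIntegrality W' hr' ht'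
  obtain ⟨qd, hqd, hB2⟩ := stub_swappedLedger hGZ hGZK hL hMi W hcm hr0 hρ hT hpos hSel1 K hIQ hodd h3 hHe hsq1 hsq2 Wd hWd hrd hSel
    hDEF K' hIQ' hHe' Dt' hc' β' ι' d₁' P' hP' hnd W' hW' hr' ht' q' hq'
  exact ⟨qd, hqd, by omega⟩

/-- **G — THE VALUATION LEDGER (stub, rank 3; PRINT-level bookkeeping, provable from tree pieces).**  On a K₁ frame, modulo the route's
four print items: for the rational values `qW = #Ш_an(E)`, `qd = #Ш_an(Wd)`, **`2·M₀ ≤ ord₂ qW + ord₂ qd`** (in truth `=`).  Assembly recipe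
for a prover: `RankOneAtTwoOneDoor…padicValRat_shaAnOverC_heegnerC` (Gross–Zagier: `ord₂ Ш_an(E/K) = 2·M₀ − 2·ord₂ c`, here `c` odd) +
Milne's any-model quotient identity (`MilneAnyModel`; defect additivity `δ(E/K) = δ(E) + δ(Wd)`, cf. `missingPPartOverCAt_baseChange_iff_bsdp`)
+ the three unconditional vanishings `Ш(E/K)[2^∞] = 0` (`Lossless.natCard_primaryComponent_sha_baseChange_two_eq_one_of_natCard_selmerGroup_eq_one`),
`Ш(E)[2] = 0` (`#Sel₂(E) = 1`), `Ш(Wd)[2] = 0` (`#Sel₂(Wd) = 2`, rank `1` by `MultPublishedInputsAtTwo`).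
Why it might fail: it is print; a mismatch of period conventions (`realPeriodRat` vs the Gross–Zagier period over `K`) would show as a
constant offset — the LEAD's `shaExactC_of_bsdp_at` (equality under the BSD₂ pair) certifies the offset is `0`.
[cite: GrossZagier1986, V §2 (2.2)] [cite: GrossLMS1991, §2 Conj. 2.2] [cite: Milne1972ArithmeticAV, §1 Thm. 1] -/
theorem stub_valuationLedger (hGZ : GrossZagierAllLevels) (hGZK : MultPublishedInputsAtTwo) (hL : EntireLFunctionRat)
    (hMi : MilneAnyModel)
    (W : WeierstrassCurve ℚ) [W.IsElliptic] [W.IsGloballyMinimal] [NeZero (W.conductorNorm ℤ)]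
    (hcm : ¬ W.HasCM) (hr0 : W.analyticRank = 0) (hρ : ∀ n : ℕ, 0 < n → W.HasSurjectiveModNGaloisRep ((2 : ℤ) ^ n))
    (hT : Odd W.tamagawaProduct) (hpos : 0 < W.Δ) (hSel1 : Nat.card (W.selmerGroup 2) = 1)
    (K : Type) [Field K] [NumberField K] (hIQ : IsImaginaryQuadratic K) (hodd : Odd (NumberField.discr K))
    (h3 : NumberField.discr K ≠ -3) (hHe : SatisfiesHeegnerHypothesis (W.conductorNorm ℤ) K)
    (hsq1 : ¬ IsSquare ((NumberField.discr K : ℚ) * -|W.Δ|)) (hsq2 : ¬ IsSquare ((NumberField.discr K : ℚ) * (-(2 * |W.Δ|))))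
    (Dt : ModularParametrizationData W (W.conductorNorm ℤ))
    (hopt : ∀ z ∈ Dt.L.lattice, ∃ w ∈ periodLattice Dt.f, z = (Dt.c : ℂ) * w) (hc : Odd Dt.c)
    (β : ℤ) (ι : K →+* ℂ) (d₁ : KolyvaginHeegnerData Dt β ι 1) (hy : ¬ IsOfFinAddOrder d₁.derivedPoint)
    (M₀ : ℕ) (hdiv : ∃ Q : (W.baseChange (ringClassField K ι 1)).toAffine.Point, ((2 ^ M₀ : ℕ) : ℤ) • Q = d₁.derivedPoint)
    (hndiv : ¬ ∃ Q : (W.baseChange (ringClassField K ι 1)).toAffine.Point, ((2 ^ (M₀ + 1) : ℕ) : ℤ) • Q = d₁.derivedPoint)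
    (Wd : WeierstrassCurve ℚ) [Wd.IsElliptic] [Wd.IsGloballyMinimal]
    (hWd : ∃ C : VariableChange ℚ, C • W.quadraticTwist (NumberField.discr K : ℚ) = Wd)
    (hrd : Wd.analyticRank = 1) (hSel : Nat.card (Wd.selmerGroup 2) = 2) (hDEF : padicValNat 2 Wd.tamagawaProduct = 0)
    (qW qd : ℚ) (hqW : shaAn W = (qW : ℂ)) (hqd : shaAn Wd = (qd : ℂ)) :
    (2 * (M₀ : ℤ)) ≤ padicValRat 2 qW + padicValRat 2 qd := by
  sorry

/-- **COMPOSITION (kernel-checked; no `sorry` of its own): A → B (= B1 + Kriz–Li + B2 + B3, v1.1) → G → K₁, modulo the four print items.**  `2·M₀ ≤ ord₂ qW + ord₂ qd ≤ 0`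
contradicts `1 ≤ M₀`.  K1Pos is NOT proved (the stubs are open); no summit is proved by a line. -/
theorem K1Pos_of (hGZ : GrossZagierAllLevels) (hGZK : MultPublishedInputsAtTwo) (hL : EntireLFunctionRat) (hMi : MilneAnyModel) :
    Summit.BirchSwinnertonDyer.BirchSwinnertonDyer.Theses.GenusKolyvaginAtTwo.K1Pos := by
  intro W _ _ _ hcm hr0 hρ hT hpos hSel1 K _ _ hIQ hodd h3 hHe hsq1 hsq2 Dt hopt hc β ι d₁ hy M₀ hdiv hndiv hM₀ Wd _ _ hWd hrd hSel hDEF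
  obtain ⟨qW, hqW, hA⟩ := stub_rankZeroHalf W hcm hr0 hρ hT hpos hSel1
  obtain ⟨qd, hqd, hB⟩ := rankOneHalf_of_swap hGZ hGZK hL hMi W hcm hr0 hρ hT hpos hSel1 K hIQ hodd h3 hHe hsq1 hsq2 Wd hWd hrd hSel hDEF
  have hG := stub_valuationLedger hGZ hGZK hL hMi W hcm hr0 hρ hT hpos hSel1 K hIQ hodd h3 hHe hsq1 hsq2 Dt hopt hc β ι d₁ hy M₀ hdiv
    hndiv Wd hWd hrd hSel hDEF qW qd hqW hqd
  omega

/-! ## v1.2 — A READ AGAINST THE RANK-ZERO WALL (cross-route, BY NAME; nothing proved)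

Stub A is WEAKER than BSD₂ on the cell: `#Sel₂(E) = 1` gives `Ш(E/ℚ)[2^∞] = 0`
(`primaryComponent_sha_eq_bot_of_natCard_selmerGroup_eq_one`, tree), so Miller's `BSD(E,2)` reads `ord₂ Ш_an(E) = 0`.  The four OPEN
wall rows of route `ByReductionTypeAtTwo` — `GoodOrdinaryRankZeroAtTwo` (19095), `MultiplicativeRankZeroAtTwo` (19096),
`SupersingularRankZeroAtTwo` (19097), `AdditiveRankZeroAtTwo` (19098), each «¬CM → r_an = 0 → <reduction type at 2> → BSDp W 2» — cover A's
binders literally, by the reduction-type tetrachotomy at `2` (LINE 23 «twin_swap» P1 door).  So K₁⁻ reads «closed modulo {WALL row 1 on the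
#Sel₂ = 1 slice, B1, B2, B3, G} + the four print items», and the line acquires NO private rank-zero input.  No wall row is proved here. -/

open Summit.BirchSwinnertonDyer.BirchSwinnertonDyer.Theses.ByReductionTypeAtTwo
  (GoodOrdinaryRankZeroAtTwo MultiplicativeRankZeroAtTwo SupersingularRankZeroAtTwo AdditiveRankZeroAtTwo) in
/-- A ⟸ WALL row 1 (ByReductionTypeAtTwo 19095–19098, by name) on the `#Sel₂ = 1` slice: `BSDp W 2` + `Ш(E/ℚ)[2^∞] = ⊥` ⟹ `ord₂ Ш_an(E) = 0 ≤ 0`.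
Sorry-free. [cite: Miller2011LMS, Def. 1.1] [cite: SilvermanAEC2009, Thm X.4.2] -/
theorem rankZeroHalf_of_wall (hOrd : GoodOrdinaryRankZeroAtTwo) (hMult : MultiplicativeRankZeroAtTwo)
    (hSS : SupersingularRankZeroAtTwo) (hAdd : AdditiveRankZeroAtTwo)
    (W : WeierstrassCurve ℚ) [W.IsElliptic] [W.IsGloballyMinimal]
    (hcm : ¬ W.HasCM) (hr0 : W.analyticRank = 0) (hSel1 : Nat.card (W.selmerGroup 2) = 1) :
    ∃ q : ℚ, shaAn W = (q : ℂ) ∧ padicValRat 2 q ≤ 0 := by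
  haveI : Fact (Nat.Prime 2) := ⟨Nat.prime_two⟩
  have hB : BSDp W 2 := by
    by_cases hg : W.HasGoodReductionAtPrime 2
    · by_cases hd : ((2 : ℕ) : ℤ) ∣ W.frobeniusTrace 2
      · exact hSS W hcm hr0 ⟨hg, hd⟩
      · exact hOrd W hcm hr0 ⟨hg, hd⟩
    · by_cases hm : W.HasMultiplicativeReductionAtPrime 2
      · exact hMult W hcm hr0 hm
      · exact hAdd W hcm hr0 ⟨hg, hm⟩
  have h1' : Nat.card (W.selmerGroup ((2 : ℕ) : ℤ)) = 1 := by rw [Nat.cast_ofNat]; exact hSel1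
  have hbot : AddCommGroup.primaryComponent (↥W.sha) 2 = ⊥ :=
    primaryComponent_sha_eq_bot_of_natCard_selmerGroup_eq_one W 2 h1'
  have hcard : Nat.card (AddCommGroup.primaryComponent (↥W.sha) 2) = 1 := by
    rw [hbot]; exact AddSubgroup.card_bot
  obtain ⟨_, _, q, hq, hv⟩ := hB
  refine ⟨q, hq, ?_⟩
  rw [hv, hcard]
  simp

open Summit.BirchSwinnertonDyer.BirchSwinnertonDyer.Theses.ByReductionTypeAtTwo
  (GoodOrdinaryRankZeroAtTwo MultiplicativeRankZeroAtTwo SupersingularRankZeroAtTwo AdditiveRankZeroAtTwo) in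
/-- **v1.2 COMPOSITION READ AGAINST THE WALL (kernel-checked; no `sorry` of its own):** K₁⁻ ⟸ WALL row 1 (four `ByReductionTypeAtTwo`
rows, by name) + B1 + B2 + B3 + G, modulo the four print items.  The open content OF THIS LINE is then B1 (one (★)-frame), B2/B3 (ledger +
integrality) and G; the rank-zero input is the programme's wall, not a private stub.  K1Pos is NOT proved; no summit is proved by a line. -/
theorem K1Pos_of_wall (hOrd : GoodOrdinaryRankZeroAtTwo) (hMult : MultiplicativeRankZeroAtTwo)
    (hSS : SupersingularRankZeroAtTwo) (hAdd : AdditiveRankZeroAtTwo)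
    (hGZ : GrossZagierAllLevels) (hGZK : MultPublishedInputsAtTwo) (hL : EntireLFunctionRat) (hMi : MilneAnyModel) :
    Summit.BirchSwinnertonDyer.BirchSwinnertonDyer.Theses.GenusKolyvaginAtTwo.K1Pos := by
  intro W _ _ _ hcm hr0 hρ hT hpos hSel1 K _ _ hIQ hodd h3 hHe hsq1 hsq2 Dt hopt hc β ι d₁ hy M₀ hdiv hndiv hM₀ Wd _ _ hWd hrd hSel hDEF
  obtain ⟨qW, hqW, hA⟩ := rankZeroHalf_of_wall hOrd hMult hSS hAdd W hcm hr0 hSel1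
  obtain ⟨qd, hqd, hB⟩ := rankOneHalf_of_swap hGZ hGZK hL hMi W hcm hr0 hρ hT hpos hSel1 K hIQ hodd h3 hHe hsq1 hsq2 Wd hWd hrd hSel hDEF
  have hG := stub_valuationLedger hGZ hGZK hL hMi W hcm hr0 hρ hT hpos hSel1 K hIQ hodd h3 hHe hsq1 hsq2 Dt hopt hc β ι d₁ hy M₀ hdiv
    hndiv Wd hWd hrd hSel hDEF qW qd hqW hqd
  omega

end Summit.BirchSwinnertonDyer.BirchSwinnertonDyer.Cruxes.K1Pos.SuHalves

end
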